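import Mathlib.NumberTheory.ArithmeticFunction.LFunction
import Mathlib.NumberTheory.LSeries.Basic
import Mathlib.Analysis.SpecialFunctions.Pow.Real
import Mathlib.RingTheory.PowerSeries.Inverse
import HarnessLib

/-!
# Absolute convergence of formal Euler products

Mathlib (`Mathlib.NumberTheory.ArithmeticFunction.LFunction`, 2026) builds L-functions as *formal*
Dirichlet series: a local factor `f(q⁻ˢ)` is `ArithmeticFunction.ofPowerSeries q f` and an Euler
product is `ArithmeticFunction.eulerProduct f = ∏' i, f i` (a `tprod` for the topology of pointwise
eventual constancy); e.g. `WeierstrassCurve.LFunction`. It has no convergence statement for these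
objects. This file supplies the elementary analytic half of "the Euler product converges absolutely
for `Re s > σ₀`" (Silverman, *AEC* App. C §16 for elliptic curves; any text on Dirichlet series,
e.g. Apostol, *Introduction to Analytic Number Theory* §11.7, for the general mechanism):

* `Literature.NumberTheory.LFunctions.sum_norm_mul_apply_mul_rpow_le`: the weighted partial sums
  `S_σ(f; T) = ∑_{n ∈ T} ‖f n‖ n^{-σ}` are sub-multiplicative under Dirichlet convolution,
  `S_σ(g * h; T) ≤ (sup_T S_σ(g)) (sup_T S_σ(h))`;
* `Literature.NumberTheory.LFunctions.summable_norm_eulerProduct_mul_rpow`: if `f i → 1` pointwise-eventually,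
  `S_σ(f i; T) ≤ M i` for all `T` and `∏_{i ∈ s} M i ≤ C` for all finite `s`, then
  `∑ₙ ‖(eulerProduct f) n‖ n^{-σ} < ∞`;
* `Literature.NumberTheory.LFunctions.sum_norm_ofPowerSeries_apply_mul_rpow_le`: `S_σ(f(q⁻ˢ); T) ≤ ∑ₖ mₖ` for any convergent
  majorant `‖coeff k f‖ q^{-kσ} ≤ mₖ`;
* `Literature.NumberTheory.LFunctions.coeff_invOfUnit_quadratic`, `Literature.NumberTheory.LFunctions.abs_coeff_invOfUnit_quadratic_le`: the coefficients of
  `(1 - aT + qT²)⁻¹` satisfy the linear recursion, and `|cₙ| ≤ (n+1) (√q)ⁿ` when `a² ≤ 4q`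
  (the shape guaranteed by the Hasse bound `|a| ≤ 2√q`, Silverman *AEC* Thm. V.1.1);
* `Literature.NumberTheory.LFunctions.LSeriesSummable_intCast_of_summable_norm_mul_rpow`: passage to Mathlib's
  `LSeriesSummable` for `ℤ`-valued coefficients.

All statements are folklore; they are used in
`Literature.NumberTheory.EllipticCurves.LSeriesSummable` to reduce the absolute convergence of
`L(E, s)` on `Re s > 3/2` to the Hasse bound.

## References

* J. H. Silverman, *The Arithmetic of Elliptic Curves*, 2nd ed., GTM 106 (2009), Thm. V.1.1 and
  App. C §16 (p. 449–450).
* T. M. Apostol, *Introduction to Analytic Number Theory* (1976), §11.7 (Euler products).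
-/

noncomputable section

open Filter Finset Real ArithmeticFunction

namespace Literature.NumberTheory.LFunctions

section EulerProduct


variable {ι R : Type*} [NormedCommRing R]

/-- Sub-multiplicativity of the weighted partial sums `∑_{n ∈ T} ‖f n‖ n^{-σ}` under Dirichlet
convolution: if the partial sums of `g` are bounded by `A` and those of `h` by `B`, then those of
`g * h` are bounded by `A * B`. [folklore] -/
theorem sum_norm_mul_apply_mul_rpow_le {g h : ArithmeticFunction R} {σ A B : ℝ}
    (hg : ∀ T : Finset ℕ, ∑ n ∈ T, ‖g n‖ * (n : ℝ) ^ (-σ) ≤ A)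
    (hh : ∀ T : Finset ℕ, ∑ n ∈ T, ‖h n‖ * (n : ℝ) ^ (-σ) ≤ B) (T : Finset ℕ) :
    ∑ n ∈ T, ‖(g * h) n‖ * (n : ℝ) ^ (-σ) ≤ A * B := by
  classical
  have hA : 0 ≤ A := by simpa using hg ∅
  -- the weighted terms
  set u : ℕ → ℝ := fun n ↦ ‖g n‖ * (n : ℝ) ^ (-σ) with hu
  set v : ℕ → ℝ := fun n ↦ ‖h n‖ * (n : ℝ) ^ (-σ) with hv
  have hu0 : ∀ n, 0 ≤ u n := fun n ↦ by positivity
  have hv0 : ∀ n, 0 ≤ v n := fun n ↦ by positivity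
  -- pointwise bound by the antidiagonal sum
  have hpt : ∀ n, ‖(g * h) n‖ * (n : ℝ) ^ (-σ) ≤
      ∑ x ∈ n.divisorsAntidiagonal, u x.1 * v x.2 := by
    intro n
    rw [mul_apply]
    calc ‖∑ x ∈ n.divisorsAntidiagonal, g x.1 * h x.2‖ * (n : ℝ) ^ (-σ)
        ≤ (∑ x ∈ n.divisorsAntidiagonal, ‖g x.1‖ * ‖h x.2‖) * (n : ℝ) ^ (-σ) := by
          gcongr
          exact (norm_sum_le _ _).trans (sum_le_sum fun x _ ↦ norm_mul_le _ _)
      _ = ∑ x ∈ n.divisorsAntidiagonal, u x.1 * v x.2 := by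
          rw [sum_mul]
          refine sum_congr rfl fun x hx ↦ ?_
          obtain ⟨hxn, -⟩ := Nat.mem_divisorsAntidiagonal.mp hx
          simp only [hu, hv]
          rw [← hxn, Nat.cast_mul,
            mul_rpow (Nat.cast_nonneg _) (Nat.cast_nonneg _)]
          ring
  -- the antidiagonals of distinct `n` are disjoint
  set U : Finset (ℕ × ℕ) := T.biUnion Nat.divisorsAntidiagonal with hU
  have hdisj : (T : Set ℕ).PairwiseDisjoint Nat.divisorsAntidiagonal := by
    intro m _ n _ hmn
    rw [Function.onFun, disjoint_left]
    intro x hxm hxn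
    exact hmn ((Nat.mem_divisorsAntidiagonal.mp hxm).1.symm.trans
      (Nat.mem_divisorsAntidiagonal.mp hxn).1)
  calc ∑ n ∈ T, ‖(g * h) n‖ * (n : ℝ) ^ (-σ)
      ≤ ∑ n ∈ T, ∑ x ∈ n.divisorsAntidiagonal, u x.1 * v x.2 := sum_le_sum fun n _ ↦ hpt n
    _ = ∑ x ∈ U, u x.1 * v x.2 := (sum_biUnion hdisj).symm
    _ ≤ ∑ x ∈ (U.image Prod.fst) ×ˢ (U.image Prod.snd), u x.1 * v x.2 :=
        sum_le_sum_of_subset_of_nonneg subset_product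
          fun x _ _ ↦ mul_nonneg (hu0 _) (hv0 _)
    _ = (∑ a ∈ U.image Prod.fst, u a) * ∑ b ∈ U.image Prod.snd, v b := by
        rw [sum_product, sum_mul_sum]
    _ ≤ A * B := by
        refine mul_le_mul (hg _) (hh _) (sum_nonneg fun b _ ↦ hv0 b) hA

variable [NormOneClass R]

/-- The weighted partial sums of `1 = δ` are at most `1`. [folklore] -/
theorem sum_norm_one_apply_mul_rpow_le (σ : ℝ) (T : Finset ℕ) :
    ∑ n ∈ T, ‖(1 : ArithmeticFunction R) n‖ * (n : ℝ) ^ (-σ) ≤ 1 := by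
  classical
  have key : ∀ n : ℕ, ‖(1 : ArithmeticFunction R) n‖ * (n : ℝ) ^ (-σ) =
      if n = 1 then 1 else 0 := by
    intro n
    rw [one_apply]
    split_ifs with h
    · simp [h]
    · simp
  rw [sum_congr rfl fun n _ ↦ key n, sum_ite_eq']
  split_ifs <;> norm_num

/-- Weighted partial sums of a finite product of arithmetic functions are bounded by the product
of the bounds. [folklore] -/
theorem sum_norm_prod_apply_mul_rpow_le {f : ι → ArithmeticFunction R} {σ : ℝ} {M : ι → ℝ}
    (hM : ∀ i (T : Finset ℕ), ∑ n ∈ T, ‖f i n‖ * (n : ℝ) ^ (-σ) ≤ M i)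
    (s : Finset ι) (T : Finset ℕ) :
    ∑ n ∈ T, ‖(∏ i ∈ s, f i) n‖ * (n : ℝ) ^ (-σ) ≤ ∏ i ∈ s, M i := by
  classical
  induction s using Finset.induction_on generalizing T with
  | empty =>
    rw [prod_empty, prod_empty]
    exact sum_norm_one_apply_mul_rpow_le σ T
  | insert j s hj ih =>
    rw [prod_insert hj, prod_insert hj]
    exact sum_norm_mul_apply_mul_rpow_le (hM j) ih T

/-- **Absolute convergence criterion for formal Euler products.** Let `f i` be arithmetic
functions converging pointwise-eventually to `1` (so that `eulerProduct f` is the pointwise limit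
of the finite partial products, `tendsTo_eulerProduct_of_tendsTo`). If the weighted partial sums
`∑_{n ∈ T} ‖f i n‖ n^{-σ}` are bounded by `M i` and the finite products `∏_{i ∈ s} M i` are
uniformly bounded, then `∑ₙ ‖(eulerProduct f) n‖ n^{-σ}` converges. This is the formal
counterpart of "an Euler product `∏ᵢ (∑ₖ |c_{i,k}| q_i^{-kσ})` that converges absolutely has an
absolutely convergent Dirichlet series". [folklore] -/
theorem summable_norm_eulerProduct_mul_rpow {f : ι → ArithmeticFunction R} {σ : ℝ}
    (h1 : ∀ n, ∀ᶠ i in cofinite, f i n = (1 : ArithmeticFunction R) n)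
    {M : ι → ℝ} (hM : ∀ i (T : Finset ℕ), ∑ n ∈ T, ‖f i n‖ * (n : ℝ) ^ (-σ) ≤ M i)
    {C : ℝ} (hC : ∀ s : Finset ι, ∏ i ∈ s, M i ≤ C) :
    Summable fun n ↦ ‖eulerProduct f n‖ * (n : ℝ) ^ (-σ) := by
  classical
  refine summable_of_sum_le (c := C) (fun n ↦ by positivity) fun T ↦ ?_
  have hev : ∀ᶠ s : Finset ι in atTop, ∀ n ∈ T, (∏ i ∈ s, f i) n = eulerProduct f n :=
    (eventually_all_finset T).mpr fun n _ ↦ tendsTo_eulerProduct_of_tendsTo f h1 n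
  obtain ⟨s, hs⟩ := hev.exists
  calc ∑ n ∈ T, ‖eulerProduct f n‖ * (n : ℝ) ^ (-σ)
      = ∑ n ∈ T, ‖(∏ i ∈ s, f i) n‖ * (n : ℝ) ^ (-σ) :=
        sum_congr rfl fun n hn ↦ by rw [hs n hn]
    _ ≤ ∏ i ∈ s, M i := sum_norm_prod_apply_mul_rpow_le hM s T
    _ ≤ C := hC s

omit [NormOneClass R] in
/-- From `∑ₙ ‖F n‖ n^{-re s} < ∞` for an integer-valued arithmetic function `F` to
`LSeriesSummable (↑F) s`. [folklore] -/
theorem LSeriesSummable_intCast_of_summable_norm_mul_rpow {F : ArithmeticFunction ℤ} {s : ℂ}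
    (h : Summable fun n ↦ ‖F n‖ * (n : ℝ) ^ (-s.re)) :
    LSeriesSummable (fun n ↦ (F n : ℂ)) s := by
  refine Summable.of_norm (h.of_nonneg_of_le (fun n ↦ norm_nonneg _) fun n ↦ ?_)
  rw [LSeries.norm_term_eq]
  split_ifs with hn
  · positivity
  · rw [rpow_neg (Nat.cast_nonneg n), div_eq_mul_inv, Complex.norm_intCast, Int.norm_eq_abs]

omit [NormOneClass R] in
/-- Weighted partial sums of a local Euler factor `f(q⁻ˢ)`: they are supported on the powers of
`q` and bounded by any convergent majorant of `‖coeff k f‖ q^{-kσ}`. [folklore] -/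
theorem sum_norm_ofPowerSeries_apply_mul_rpow_le {q : ℕ} (hq : 1 < q) (φ : PowerSeries R)
    {σ S : ℝ} {m : ℕ → ℝ}
    (hmaj : ∀ k, ‖PowerSeries.coeff k φ‖ * (((q : ℝ) ^ k) ^ (-σ)) ≤ m k) (hm : HasSum m S)
    (T : Finset ℕ) :
    ∑ n ∈ T, ‖ofPowerSeries q φ n‖ * (n : ℝ) ^ (-σ) ≤ S := by
  classical
  have hinj : Function.Injective (q ^ · : ℕ → ℕ) := Nat.pow_right_injective hq
  set G : ℕ → ℝ := fun k ↦ ‖PowerSeries.coeff k φ‖ * (((q : ℝ) ^ k) ^ (-σ)) with hG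
  have hG0 : ∀ k, 0 ≤ G k := fun k ↦ by positivity
  have hGs : Summable G := hm.summable.of_nonneg_of_le hG0 hmaj
  have key : (fun n ↦ ‖ofPowerSeries q φ n‖ * (n : ℝ) ^ (-σ)) = Function.extend (q ^ ·) G 0 := by
    funext n
    by_cases hn : ∃ k, q ^ k = n
    · obtain ⟨k, rfl⟩ := hn
      rw [hinj.extend_apply, ofPowerSeries_apply_pow hq]
      simp [hG]
    · rw [Function.extend_apply' _ _ _ hn, ofPowerSeries_apply hq, Function.extend_apply' _ _ _ hn]
      simp
  have hsum : HasSum (fun n ↦ ‖ofPowerSeries q φ n‖ * (n : ℝ) ^ (-σ)) (∑' k, G k) := by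
    rw [key]
    exact (hasSum_extend_zero hinj).mpr hGs.hasSum
  calc ∑ n ∈ T, ‖ofPowerSeries q φ n‖ * (n : ℝ) ^ (-σ)
      ≤ ∑' k, G k := sum_le_hasSum T (fun n _ ↦ by positivity) hsum
    _ ≤ S := hasSum_le hmaj hGs.hasSum hm

end EulerProduct

/-! ### Coefficients of `(1 - a T + b T²)⁻¹` -/

section PowerSeries

open PowerSeries

variable {S : Type*} [CommRing S]

/-- The coefficients `cₙ` of `(1 - aT + bT²)⁻¹` satisfy `c₀ = 1`, `c₁ = a`,
`c_{n+2} = a c_{n+1} - b cₙ`. [folklore] -/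
theorem coeff_invOfUnit_quadratic (a b : S) :
    coeff 0 (invOfUnit (1 - C a * X + C b * X ^ 2) 1) = 1 ∧
    coeff 1 (invOfUnit (1 - C a * X + C b * X ^ 2) 1) = a ∧
    ∀ n, coeff (n + 2) (invOfUnit (1 - C a * X + C b * X ^ 2) 1) =
      a * coeff (n + 1) (invOfUnit (1 - C a * X + C b * X ^ 2) 1)
        - b * coeff n (invOfUnit (1 - C a * X + C b * X ^ 2) 1) := by
  set φ := invOfUnit (1 - C a * X + C b * X ^ 2 : S⟦X⟧) 1 with hφ
  have hp : constantCoeff (1 - C a * X + C b * X ^ 2 : S⟦X⟧) = ((1 : Sˣ) : S) := by simp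
  have hmul : (1 - C a * X + C b * X ^ 2 : S⟦X⟧) * φ = 1 := mul_invOfUnit _ 1 hp
  have hexp : (1 - C a * X + C b * X ^ 2 : S⟦X⟧) * φ = φ - C a * (X * φ) + C b * (X * (X * φ)) := by
    ring
  rw [hexp] at hmul
  have h0 : coeff 0 φ = 1 := by
    rw [coeff_zero_eq_constantCoeff_apply, hφ, constantCoeff_invOfUnit]; simp
  refine ⟨h0, ?_, fun n ↦ ?_⟩
  · have := congrArg (coeff 1) hmul
    simp only [map_sub, map_add, coeff_C_mul, coeff_succ_X_mul, coeff_zero_X_mul, coeff_one] at this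
    rw [h0] at this
    simp only [mul_one, one_ne_zero, if_false, mul_zero, add_zero] at this
    linear_combination this
  · have := congrArg (coeff (n + 2)) hmul
    simp only [map_sub, map_add, coeff_C_mul, coeff_succ_X_mul, coeff_one] at this
    rw [if_neg (by omega : n + 2 ≠ 0)] at this
    linear_combination this

/-- The coefficients of `(1 - aT)⁻¹` are `aⁿ`. [folklore] -/
theorem coeff_invOfUnit_one_sub_C_mul_X (a : S) (n : ℕ) :
    coeff n (invOfUnit (1 - C a * X) 1) = a ^ n := by
  obtain ⟨h0, h1, h2⟩ := coeff_invOfUnit_quadratic a (0 : S)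
  simp only [_root_.map_zero, zero_mul, add_zero] at h0 h1 h2
  induction n using Nat.twoStepInduction with
  | zero => rw [pow_zero]; exact h0
  | one => rw [pow_one]; exact h1
  | more n ih0 ih1 => rw [h2 n, ih1]; ring

/-- **Coefficient bound for a local Euler factor of weight one.** If `a, q ∈ ℤ` with `a² ≤ 4q`
(the Hasse–Weil shape: `1 - aT + qT² = (1 - αT)(1 - βT)` with `|α| = |β| = √q`), then the
coefficients `cₙ` of `(1 - aT + qT²)⁻¹ ∈ ℤ⟦T⟧` satisfy `|cₙ| ≤ (n + 1) (√q)ⁿ`. [folklore] -/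
theorem abs_coeff_invOfUnit_quadratic_le {a q : ℤ} (ha : a ^ 2 ≤ 4 * q) (n : ℕ) :
    |((coeff n (invOfUnit (1 - C a * X + C q * X ^ 2 : ℤ⟦X⟧) 1) : ℤ) : ℝ)| ≤
      (n + 1) * Real.sqrt q ^ n := by
  obtain ⟨h0, h1, h2⟩ := coeff_invOfUnit_quadratic a q
  set c : ℕ → ℤ := fun n ↦ coeff n (invOfUnit (1 - C a * X + C q * X ^ 2 : ℤ⟦X⟧) 1) with hc
  have h0' : c 0 = 1 := h0
  have h1' : c 1 = a := h1
  have h2' : ∀ n, c (n + 2) = a * c (n + 1) - q * c n := h2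
  -- the two complex roots of `z² - a z + q`
  set s : ℝ := Real.sqrt (4 * q - a ^ 2) with hs
  have hs2 : s * s = 4 * q - a ^ 2 := Real.mul_self_sqrt (by exact_mod_cast sub_nonneg.mpr ha)
  set α : ℂ := ⟨a / 2, s / 2⟩ with hα
  set β : ℂ := ⟨a / 2, -(s / 2)⟩ with hβ
  have hsum : α + β = (a : ℂ) := Complex.ext (by simp [hα, hβ]) (by simp [hα, hβ])
  have hprod : α * β = (q : ℂ) := by
    refine Complex.ext ?_ ?_
    · simp only [Complex.mul_re, hα, hβ, Complex.intCast_re]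
      nlinarith [hs2]
    · simp only [Complex.mul_im, hα, hβ, Complex.intCast_im]
      ring
  have hnorm : ∀ z : ℂ, z.re = a / 2 → z.im * z.im = s / 2 * (s / 2) → ‖z‖ = Real.sqrt q := by
    intro z hre him
    rw [Complex.norm_def, Complex.normSq_apply]
    congr 1
    rw [hre, him]
    nlinarith [hs2]
  have hnα : ‖α‖ = Real.sqrt q := hnorm α rfl rfl
  have hnβ : ‖β‖ = Real.sqrt q := hnorm β rfl (by simp [hβ])
  -- `c_{n+1} = α c_n + β^{n+1}` in `ℂ`
  have hrec : ∀ n, (c (n + 1) : ℂ) = α * c n + β ^ (n + 1) := by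
    intro n
    induction n with
    | zero =>
      rw [h1', h0']
      push_cast
      linear_combination -hsum
    | succ n ih =>
      rw [h2' n]
      push_cast
      rw [ih]
      linear_combination -(α * (c n : ℂ) + β ^ (n + 1)) * hsum + (c n : ℂ) * hprod
  -- the bound, by induction
  have key : ∀ n, ‖(c n : ℂ)‖ ≤ (n + 1) * Real.sqrt q ^ n := by
    intro n
    induction n with
    | zero => simp [h0']
    | succ n ih =>
      rw [hrec n]
      calc ‖α * (c n : ℂ) + β ^ (n + 1)‖
          ≤ ‖α‖ * ‖(c n : ℂ)‖ + ‖β‖ ^ (n + 1) := by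
            refine (norm_add_le _ _).trans (add_le_add (norm_mul_le _ _) ?_)
            rw [norm_pow]
        _ ≤ Real.sqrt q * ((n + 1) * Real.sqrt q ^ n) + Real.sqrt q ^ (n + 1) := by
            rw [hnα, hnβ]; gcongr
        _ = ((n + 1 : ℕ) + 1) * Real.sqrt q ^ (n + 1) := by push_cast; ring
  have := key n
  rwa [Complex.norm_intCast] at this

end PowerSeries

end Literature.NumberTheory.LFunctions

end
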